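import Mathlib
import HarnessLib

/-!
# Route IsogenyRedei, crux `PencilSelmerDictionary` (stmt-Parity-11584): combinatorics of the
# squarefree divisors of `t² + 1` (auxiliary file for stub E `stub_twoAdicKernelCount`)

Line `toric-node-vacuity-cassels` counts the explicit `b`-side Selmer set of the pencil
`E_t = ⟨0, 2t, 0, t² + 1, 0⟩`: the positive squarefree divisors `d ∣ t² + 1` passing a 2-adic table
that only depends on the class of `d` in `ℚ₂ˣ/ℚ₂ˣ² ∈ {1, 5, 2, 10}`. This file provides the generic
bookkeeping:

* `prod_mod_eight_eq` — a product of numbers `≡ 1, 5 (mod 8)` is `≡ 1` or `≡ 5 (mod 8)` according to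
  the parity of the number of factors `≡ 5 (mod 8)`;
* `card_powerset_filter_even_eq`, `card_powerset_filter_not_even_eq`,
  `powerset_filter_even_eq_of_forall_not` — the number of subsets `S ⊆ Q` with an even (odd) number of
  elements satisfying a predicate `π` is `2^{|Q|−1}` as soon as one element of `Q` satisfies `π`
  (decomposition `𝒫(insert a Q') = 𝒫(Q') ⊔ insert a '' 𝒫(Q')`, the parity flips on the second part),
  and all of `𝒫(Q)` when none does;
* `squarefreeDivisors_eq_image` — the positive squarefree divisors of `n ≠ 0` are exactly the
  products of the subsets of `n.primeFactors`, injectively.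

Everything is elementary and proved; no definitions beyond local notation, no named facts.
[folklore]
-/

namespace Summit.Parity.BatemanHorn.Theorems.PencilSelmerDictionary

open Finset

/-! ## Products modulo `8` -/

/-- A product of natural numbers each `≡ 1` or `≡ 5 (mod 8)` is `≡ 1 (mod 8)` if the number of
factors `≡ 5 (mod 8)` is even and `≡ 5 (mod 8)` otherwise. [folklore] -/
theorem prod_mod_eight_eq (S : Finset ℕ) (h : ∀ p ∈ S, p % 8 = 1 ∨ p % 8 = 5) :
    (∏ p ∈ S, p) % 8 = if Even (S.filter (fun p => p % 8 = 5)).card then 1 else 5 := by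
  classical
  induction S using Finset.induction_on with
  | empty => simp
  | insert a S ha ih =>
    have h' : ∀ p ∈ S, p % 8 = 1 ∨ p % 8 = 5 := fun p hp => h p (mem_insert_of_mem hp)
    have ihS := ih h'
    have ha' : a ∉ S.filter (fun p => p % 8 = 5) := fun hm => ha (mem_of_mem_filter a hm)
    rcases h a (mem_insert_self a S) with h1 | h5
    · have hfil : (insert a S).filter (fun p => p % 8 = 5) = S.filter (fun p => p % 8 = 5) := by
        rw [filter_insert, if_neg (by omega)]
      by_cases hE : Even (S.filter (fun p => p % 8 = 5)).card
      · have hE' : Even ((insert a S).filter (fun p => p % 8 = 5)).card := by rwa [hfil]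
        rw [if_pos hE', prod_insert ha, Nat.mul_mod, ihS, if_pos hE, h1]
      · have hE' : ¬ Even ((insert a S).filter (fun p => p % 8 = 5)).card := by rwa [hfil]
        rw [if_neg hE', prod_insert ha, Nat.mul_mod, ihS, if_neg hE, h1]
    · have hfil : ((insert a S).filter (fun p => p % 8 = 5)).card =
          (S.filter (fun p => p % 8 = 5)).card + 1 := by
        rw [filter_insert, if_pos h5, card_insert_of_notMem ha']
      by_cases hE : Even (S.filter (fun p => p % 8 = 5)).card
      · have hE' : ¬ Even ((insert a S).filter (fun p => p % 8 = 5)).card := by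
          rw [hfil, Nat.even_add_one]; exact not_not.mpr hE
        rw [if_neg hE', prod_insert ha, Nat.mul_mod, ihS, if_pos hE, h5]
      · have hE' : Even ((insert a S).filter (fun p => p % 8 = 5)).card := by
          rw [hfil, Nat.even_add_one]; exact hE
        rw [if_pos hE', prod_insert ha, Nat.mul_mod, ihS, if_neg hE, h5]

/-! ## Subsets with an even number of marked elements -/

section Parity

variable {α : Type*} [DecidableEq α] (π : α → Prop) [DecidablePred π]

/-- Inserting a marked element flips the parity of the number of marked elements. [folklore] -/
theorem even_card_filter_insert_iff {a : α} {S : Finset α} (ha : a ∉ S) (hπ : π a) :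
    Even ((insert a S).filter π).card ↔ ¬ Even (S.filter π).card := by
  have ha' : a ∉ S.filter π := fun hm => ha (mem_of_mem_filter a hm)
  rw [filter_insert, if_pos hπ, card_insert_of_notMem ha', Nat.even_add_one]

/-- Inserting an unmarked element does not change the number of marked elements. [folklore] -/
theorem card_filter_insert_of_not {a : α} {S : Finset α} (hπ : ¬ π a) :
    ((insert a S).filter π).card = (S.filter π).card := by
  rw [filter_insert, if_neg hπ]

/-- `insert a` is injective on the subsets of a set not containing `a`. [folklore] -/
theorem insert_injOn_powerset {a : α} {Q : Finset α} (ha : a ∉ Q) :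
    Set.InjOn (insert a) (Q.powerset : Set (Finset α)) := by
  intro S hS T hT hST
  have haS : a ∉ S := fun h => ha (mem_powerset.mp hS h)
  have haT : a ∉ T := fun h => ha (mem_powerset.mp hT h)
  rw [← erase_insert haS, hST, erase_insert haT]

/-- **Counting subsets by parity through one marked element.** If `a ∉ Q'` is marked, the subsets of
`insert a Q'` satisfying a property `E` are the subsets `S` of `Q'` with `E S` plus those with
`E (insert a S)`. [folklore] -/
theorem card_powerset_insert_filter {a : α} {Q' : Finset α} (ha : a ∉ Q') (E : Finset α → Prop)
    [DecidablePred E] :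
    ((insert a Q').powerset.filter E).card =
      (Q'.powerset.filter E).card + (Q'.powerset.filter fun S => E (insert a S)).card := by
  rw [powerset_insert, filter_union, card_union_of_disjoint, filter_image,
    card_image_of_injOn ((insert_injOn_powerset ha).mono (coe_subset.mpr (filter_subset _ _)))]
  rw [disjoint_left]
  intro S hS hS'
  obtain ⟨T, -, rfl⟩ := mem_image.mp (mem_of_mem_filter _ hS')
  have : a ∈ insert a T := mem_insert_self a T
  exact ha (mem_powerset.mp (mem_of_mem_filter _ hS) this)

/-- **Parity halving.** If some element of `Q` is marked, exactly `2^{|Q| − 1}` subsets of `Q` have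
an even number of marked elements. [folklore] -/
theorem card_powerset_filter_even_eq (Q : Finset α) (h : ∃ a ∈ Q, π a) :
    (Q.powerset.filter fun S => Even (S.filter π).card).card = 2 ^ (Q.card - 1) := by
  obtain ⟨a, haQ, hπa⟩ := h
  have hQ : insert a (Q.erase a) = Q := insert_erase haQ
  have ha : a ∉ Q.erase a := notMem_erase a Q
  rw [← hQ, card_powerset_insert_filter ha, card_insert_of_notMem ha]
  have hcongr : ((Q.erase a).powerset.filter fun S => Even ((insert a S).filter π).card) =
      (Q.erase a).powerset.filter fun S => ¬ Even (S.filter π).card := by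
    refine filter_congr fun S hS => ?_
    exact even_card_filter_insert_iff π (fun h => ha (mem_powerset.mp hS h)) hπa
  rw [hcongr, card_filter_add_card_filter_not, card_powerset]
  simp

/-- **Parity halving, odd half.** If some element of `Q` is marked, exactly `2^{|Q| − 1}` subsets
of `Q` have an odd number of marked elements. [folklore] -/
theorem card_powerset_filter_not_even_eq (Q : Finset α) (h : ∃ a ∈ Q, π a) :
    (Q.powerset.filter fun S => ¬ Even (S.filter π).card).card = 2 ^ (Q.card - 1) := by
  have hpos : 1 ≤ Q.card := by
    obtain ⟨a, haQ, _⟩ := h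
    exact card_pos.mpr ⟨a, haQ⟩
  have htot := card_filter_add_card_filter_not
    (s := Q.powerset) (p := fun S => Even (S.filter π).card)
  rw [card_powerset_filter_even_eq π Q h, card_powerset] at htot
  have h2 : 2 ^ Q.card = 2 ^ (Q.card - 1) + 2 ^ (Q.card - 1) := by
    conv_lhs => rw [show Q.card = (Q.card - 1) + 1 by omega, pow_succ]
    ring
  omega

omit [DecidableEq α] in
/-- If no element of `Q` is marked, every subset has an even number (zero) of marked elements.
[folklore] -/
theorem powerset_filter_even_eq_of_forall_not (Q : Finset α) (h : ∀ a ∈ Q, ¬ π a) :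
    (Q.powerset.filter fun S => Even (S.filter π).card) = Q.powerset := by
  refine filter_true_of_mem fun S hS => ?_
  have : S.filter π = ∅ :=
    filter_false_of_mem fun x hx => h x (mem_powerset.mp hS hx)
  simp [this]

end Parity

/-! ## Squarefree divisors as products of subsets of the prime factors -/

/-- A product of distinct primes is squarefree. [folklore] -/
theorem squarefree_prod_of_subset_primeFactors {n : ℕ} {S : Finset ℕ} (hS : S ⊆ n.primeFactors) :
    Squarefree (∏ p ∈ S, p) := by
  refine Finset.squarefree_prod_of_pairwise_isCoprime ?_ fun p hp =>
    (Nat.prime_of_mem_primeFactors (hS hp)).prime.squarefree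
  intro p hp q hq hpq
  exact Nat.coprime_iff_isRelPrime.mp ((Nat.coprime_primes (Nat.prime_of_mem_primeFactors (hS hp))
    (Nat.prime_of_mem_primeFactors (hS hq))).mpr hpq)

/-- A product over a subset of the prime factors of `n` divides `n`. [folklore] -/
theorem prod_dvd_of_subset_primeFactors {n : ℕ} {S : Finset ℕ} (hS : S ⊆ n.primeFactors) :
    (∏ p ∈ S, p) ∣ n :=
  (Finset.prod_dvd_prod_of_subset S n.primeFactors (fun p => p) hS).trans (Nat.prod_primeFactors_dvd n)

/-- **The positive squarefree divisors of `n ≠ 0` are the products of the subsets of its prime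
factors** (as finsets of naturals). [folklore] -/
theorem squarefreeDivisors_eq_image :
    ∀ {n : ℕ}, n ≠ 0 → n.divisors.filter Squarefree = n.primeFactors.powerset.image fun S => ∏ p ∈ S, p := by
  intro n hn
  ext m
  simp only [mem_filter, Nat.mem_divisors, mem_image, mem_powerset]
  constructor
  · rintro ⟨⟨hdvd, -⟩, hsq⟩
    exact ⟨m.primeFactors, Nat.primeFactors_mono hdvd hn, Nat.prod_primeFactors_of_squarefree hsq⟩
  · rintro ⟨S, hS, rfl⟩
    exact ⟨⟨prod_dvd_of_subset_primeFactors hS, hn⟩, squarefree_prod_of_subset_primeFactors hS⟩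

/-- The product map is injective on the subsets of the prime factors. [folklore] -/
theorem prod_injOn_powerset_primeFactors (n : ℕ) :
    Set.InjOn (fun S : Finset ℕ => ∏ p ∈ S, p) (n.primeFactors.powerset : Set (Finset ℕ)) := by
  intro S hS T hT hST
  have hS' : ∀ p ∈ S, p.Prime := fun p hp =>
    Nat.prime_of_mem_primeFactors (mem_powerset.mp (mem_coe.mp hS) hp)
  have hT' : ∀ p ∈ T, p.Prime := fun p hp =>
    Nat.prime_of_mem_primeFactors (mem_powerset.mp (mem_coe.mp hT) hp)
  have := congrArg Nat.primeFactors hST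
  simpa [Nat.primeFactors_prod hS', Nat.primeFactors_prod hT'] using this

end Summit.Parity.BatemanHorn.Theorems.PencilSelmerDictionary
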